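import Summits.NavierStokesRegularity.NavierStokesRegularity.Theorems.ScenarioCensusRowF1nvTop

/-!
# Census row F1nv (Type I · Clay · negligible vertical top) — part 2/2: the horizontal singular Type-I zoom
# limit; F1nv ⊇ F1flat, F1v∞ DECIDED; vertical persistence; `VerticalNegligibility ↔ Row_F1`; census keys

Re-homed for the scenario census (typer seat ns-census-typer-1 g5; lead MINT INTENT F1nv 2026-08-28T15:11Z) from
ns-idea-3 g6's LINE 9 «flat-top» (`line-flat-top.lean`, sha16 89f5a64a93087254; ref g7 PRE-CHECK ✓ 15:16Z), continuing
`ScenarioCensusRowF1nvTop` (part 1/2).  Lean text verbatim in namespace `…Theorems.ScenarioCensus.FlatTop` (the line's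
`set_option maxHeartbeats 400000 in` dropped — the proof elaborates at the default).

Mechanism (all in kernel, tree tools only): (1) Type-I singular zoom at a non-extendable point (the tree's
`SqueezeCycleSingularZoom` toolkit: `exists_typeI_rate_window`, `morrey_of_typeI`, `exists_zoom_typeIBound_lt_top_of_morrey`,
`zoom_*`, `exists_tendsto_of_typeI_seq_Ioo`, `zoomSeq_unbounded_at_origin`) ⇒ pointwise limit `W ∈ 𝒦_C`, unbounded
near the origin; (2) `exists_horizontal_zoomLimit`: a negligible vertical top passes to the limit as `W₃ ≡ 0`;
(3) census row A7h, IN TREE (`HorizontalMeter.row_A7h_holds`): horizontal-valued elements of `𝒦_C` vanish —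
contradiction; (4) Lemarié-Rieusset's Thm 15.1 (C) (`hasSmoothExtensionPast_of_forall_exists_parabolicCylinder`)
extends `u` past `T`.  Headlines: `rowF1nv_holds`, `rowF1flat_holds`, `rowF1vInf_holds` (criterion rows DECIDED),
`verticalPersistence_holds`, `verticalNegligibility_iff_rowF1`, `rowF1_of_verticalNegligibility`.
Census keys (namespace `…Theorems.ScenarioCensus`): `Row_F1nv` + `row_F1nv_excluded`; in-row `Row_F1flat` +
`row_F1flat_excluded`, `Row_F1vInf` + `row_F1vInf_excluded`; display `VerticalNegligibility`, `row_F1_iff_verticalNegligibility`.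

No census value is asserted here (the lead books F1nv); NS regularity is NOT proved; `Row_F1` stays open
(≡ `VerticalNegligibility`); no summit statement is proved by this file.
-/

noncomputable section

set_option linter.dupNamespace false

open MeasureTheory Set Function Filter TopologicalSpace Metric
open scoped Topology NNReal ENNReal InnerProductSpace RealInnerProductSpace

namespace Summit.NavierStokesRegularity.NavierStokesRegularity.Theorems.ScenarioCensus.FlatTop

open Literature.Analysis Literature.Analysis.FluidPDE
open Summit.NavierStokesRegularity.NavierStokesRegularity.Theorems
open Summit.NavierStokesRegularity.NavierStokesRegularity.Theorems.ScenarioCensus.HorizontalMeter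
  (IsHorizontalValued Row_A7h row_A7h_holds)

/-! ## §2 The horizontal singular Type-I zoom limit -/

/-- **The singular Type-I zoom limit of a negligible vertical top is horizontal-valued and nontrivial.**
Steps (1)–(4) and (6) are the tree's `singularZoom_zoomLimit` verbatim; step (4b) is new: at a limit
point with `W ≠ 0` the physical points are eventually in the top, where the zoomed vertical component
is `≤ εα/√(β|t|)` for every `ε`, so `W₃ ≡ 0`.
[cite: AlbrittonBarker2019, §3; KochNadirashviliSereginSverak2009, Lemma 6.1 (arXiv p. 11); KukavicaRusinZiane2016, Cor. 2.3] -/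
theorem exists_horizontal_zoomLimit {ν T : ℝ} (hν : 0 < ν) (hT : 0 < T)
    {u : ℝ → E3 → E3} {p : ℝ → E3 → ℝ}
    (hsol : IsClassicalNSSolutionOn (Ico 0 T) ν 0 u p) (hLH : IsLerayHopfOn T ν 0 (u 0) u)
    (hdec : HasRapidSpatialDecay (u 0)) (hTI : IsTypeIBlowup u T) (hnv : HasNegligibleVerticalTop u T)
    (x₀ : E3)
    (hsing : ∀ r : ℝ, 0 < r →
      eLpNorm (uncurry u) ∞ (volume.restrict (parabolicCylinder r ((T : ℝ), x₀))) = ∞) :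
    ∃ (C : ℝ) (W : ℝ → E3 → E3), IsTypeIAncientMild C W ∧ IsHorizontalValued W ∧
      ∃ t < 0, ∃ y, W t y ≠ 0 := by
  -- ## (1) the Type-I rate window, the Morrey bound and the unit zoom at `(T, x₀)`
  obtain ⟨C, δ, -, hδ, hδT, hrate⟩ := exists_typeI_rate_window hT hTI
  obtain ⟨r₀, M₀, T₁, hr₀, hT₁, hMor⟩ := morrey_of_typeI hν hT hsol hLH hTI
  obtain ⟨R, α, β, hR, hα, hβ, hβeq, hαeq, hβT, hball, hGv, htypeI⟩ :=
    exists_zoom_typeIBound_lt_top_of_morrey hν hT hsol hLH hr₀ hT₁ hMor x₀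
  set v : ℝ → E3 → E3 := α • stPull β R T x₀ u with hv
  set πv : ℝ → E3 → ℝ :=
    α ^ 2 • stPull β R T x₀ (fun t x => p t x - (p t 0 - normalisedPressure (u t) 0)) with hπv
  set Gv : ℝ → E3 → E3 →L[ℝ] E3 :=
    (α * R) • stPull β R T x₀ (fun t x => fderiv ℝ (u t) x) with hGvdef
  set I₀ : ℝ≥0∞ := typeIBound (parabolicCylinder (1 / 2) (0 : ℝ × E3)) v πv Gv with hI₀
  have hI₀top : I₀ ≠ ⊤ := htypeI.ne
  -- ## (2) the scales `c k = 1/(k+4) ↓ 0` and the zoom sequence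
  set c : ℕ → ℝ := fun k => 1 / ((k : ℝ) + 4) with hc
  have hcpos : ∀ k, 0 < c k := fun k => by simp only [hc]; positivity
  have hc4 : ∀ k, c k ≤ 1 / 4 := fun k =>
    div_le_div_of_nonneg_left zero_le_one (by norm_num) (by linarith [(Nat.cast_nonneg k : (0 : ℝ) ≤ k)])
  have hc2 : ∀ k, c k ≤ 1 / 2 := fun k => (hc4 k).trans (by norm_num)
  have hclim : Tendsto c atTop (𝓝 0) :=
    tendsto_const_nhds.div_atTop (tendsto_atTop_add_const_right _ _ tendsto_natCast_atTop_atTop)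
  set w : ℕ → ℝ → E3 → E3 :=
    fun k => (c k * α) • stPull (c k ^ 2 * β) (c k * R) T x₀ u with hw
  -- the final windows `(A k, 0)`, `A k → -∞`
  set A : ℕ → ℝ := fun k => -(δ / (c k ^ 2 * β)) with hA
  have hAk : ∀ k, A k = -(δ / β * ((k : ℝ) + 4) ^ 2) := by
    intro k
    simp only [hA, hc]
    field_simp
  have hAlim : Tendsto A atTop atBot := by
    have h1 : Tendsto (fun k : ℕ => ((k : ℝ) + 4) ^ 2) atTop atTop :=
      (tendsto_pow_atTop two_ne_zero).comp
        (tendsto_atTop_add_const_right _ _ tendsto_natCast_atTop_atTop)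
    have h2 : Tendsto (fun k : ℕ => δ / β * ((k : ℝ) + 4) ^ 2) atTop atTop :=
      h1.const_mul_atTop (by positivity)
    refine (tendsto_neg_atTop_atBot.comp h2).congr fun k => ?_
    rw [hAk k]
    rfl
  -- ## (3) per-scale facts
  have hcW : ∀ k, ContinuousOn (uncurry (w k)) (Ioo (A k) 0 ×ˢ univ) := fun k =>
    zoom_continuousOn hν hsol hR hαeq hβeq (hcpos k) hδT
  have hdivW : ∀ k, ∀ t ∈ Ioo (A k) 0, IsWeaklyDivFree (w k t) := fun k t ht =>
    zoom_isWeaklyDivFree hν hsol hR hαeq hβeq (hcpos k) hδT ht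
  have hmildW : ∀ k, ∀ s t : ℝ, A k < s → s < t → t < 0 → ∀ y,
      w k t y = UnboundedOperators.heatExtension (w k s) (t - s) y -
        oseenDuhamel 1 s (w k) (w k) t y := fun k s t hs hst ht y =>
    zoom_oseen hν hT hsol hLH hdec hR hαeq hβeq (hcpos k) hδT hs hst ht y
  set C₁ : ℝ := α * C / Real.sqrt β with hC₁
  have hIW : ∀ k, ∀ t ∈ Ioo (A k) 0, ∀ y, ‖w k t y‖ ≤ C₁ / Real.sqrt (-t) := fun k t ht y =>
    zoom_norm_le hR hαeq hβeq hν (hcpos k) hδT hrate ht y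
  -- ## (4) extraction of the `C¹_loc` limit `W ∈ 𝒦_{C₁}`
  obtain ⟨φ, hφ, W, hWclass, hpt, -, -, -⟩ :=
    exists_tendsto_of_typeI_seq_Ioo C₁ hAlim hcW hdivW hmildW hIW
  have hφt : Tendsto φ atTop atTop := hφ.tendsto_atTop
  have hcφ : Tendsto (fun j => c (φ j)) atTop (𝓝 0) := hclim.comp hφt
  -- ## (6) `W` is unbounded at the origin
  have hsingW : ∀ r > 0, ∀ M : ℝ, ∃ t ∈ Ioo (-(r ^ 2)) (0 : ℝ),
      ∃ x ∈ ball (0 : E3) r, M < ‖W t x‖ :=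
    zoomSeq_unbounded_at_origin (πv := πv) hsol hR hα hβ hβT hsing hball hGv hI₀top
      (fun j => hcpos (φ j)) (fun j => hc2 (φ j)) fun z hz =>
        hpt z.1 ((SuitableCompactness.mem_parabolicCylinder_zero.1 hz).1.2) z.2
  -- ## (4b) NEW: a coherent top passes to the limit — all nonzero values of `W` share one direction
  have hwu : ∀ (j : ℕ) (t : ℝ) (y : E3),
      w (φ j) t y = (c (φ j) * α) • u (T + c (φ j) ^ 2 * β * t) (x₀ + (c (φ j) * R) • y) :=
    fun j t y => by simp only [hw, smul_stPull_apply]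
  have hcα : Tendsto (fun j => c (φ j) * α) atTop (𝓝 0) := by
    simpa using hcφ.mul_const α
  have hcR : Tendsto (fun j => c (φ j) * R) atTop (𝓝 0) := by
    simpa using hcφ.mul_const R
  have hτlim : ∀ t : ℝ, Tendsto (fun j => T + c (φ j) ^ 2 * β * t) atTop (𝓝 T) := by
    intro t
    have h : Tendsto (fun j => T + c (φ j) ^ 2 * β * t) atTop (𝓝 (T + 0 ^ 2 * β * t)) :=
      (((hcφ.pow 2).mul_const β).mul_const t).const_add T
    rw [zero_pow two_ne_zero, zero_mul, zero_mul, add_zero] at h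
    exact h
  have hτT : ∀ (j : ℕ) (t : ℝ), t < 0 → T + c (φ j) ^ 2 * β * t < T := by
    intro j t ht
    have : 0 < c (φ j) ^ 2 * β := by positivity
    nlinarith
  -- points of the limit where `W ≠ 0` come from top points, eventually
  have htop : ∀ t < 0, ∀ y : E3, W t y ≠ 0 → ∀ Λ : ℝ,
      ∀ᶠ j in atTop, Λ < ‖u (T + c (φ j) ^ 2 * β * t) (x₀ + (c (φ j) * R) • y)‖ := by
    intro t ht y hne Λ
    have hpos : 0 < ‖W t y‖ := norm_pos_iff.2 hne
    have f1 : ∀ᶠ j in atTop, ‖W t y‖ / 2 < ‖w (φ j) t y‖ :=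
      ((hpt t ht y).norm).eventually_const_lt (by linarith)
    have f2 : ∀ᶠ j in atTop, c (φ j) * α * (|Λ| + 1) < ‖W t y‖ / 2 := by
      have h : Tendsto (fun j => c (φ j) * α * (|Λ| + 1)) atTop (𝓝 (0 * (|Λ| + 1))) :=
        hcα.mul_const _
      rw [zero_mul] at h
      exact h.eventually_lt_const (by linarith)
    filter_upwards [f1, f2] with j hj1 hj2
    by_contra hle
    push Not at hle
    have hcαj : 0 < c (φ j) * α := mul_pos (hcpos _) hα
    have hn : ‖w (φ j) t y‖ = c (φ j) * α * ‖u (T + c (φ j) ^ 2 * β * t) (x₀ + (c (φ j) * R) • y)‖ := by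
      rw [hwu, norm_smul, Real.norm_eq_abs, abs_of_pos hcαj]
    have hle' : ‖u (T + c (φ j) ^ 2 * β * t) (x₀ + (c (φ j) * R) • y)‖ ≤ |Λ| + 1 :=
      hle.trans ((le_abs_self Λ).trans (by linarith))
    have : ‖w (φ j) t y‖ ≤ c (φ j) * α * (|Λ| + 1) := by
      rw [hn]; exact mul_le_mul_of_nonneg_left hle' hcαj.le
    linarith
  have hvert : ∀ t < 0, ∀ y : E3, W t y 2 = 0 := by
    intro t ht y
    rcases eq_or_ne (W t y) 0 with h0 | hne
    · rw [h0]; rfl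
    have hs : 0 < Real.sqrt (β * (-t)) := Real.sqrt_pos.2 (mul_pos hβ (neg_pos.2 ht))
    have hle : ∀ ε : ℝ, 0 < ε → |W t y 2| ≤ α * ε / Real.sqrt (β * (-t)) := by
      intro ε hε
      obtain ⟨Λ, t₁, ht₁T, hΛ⟩ := hnv ε hε
      have e1 : ∀ᶠ j in atTop, t₁ < T + c (φ j) ^ 2 * β * t := (hτlim t).eventually_const_lt ht₁T
      have e4 := htop t ht y hne Λ
      have hev : ∀ᶠ j in atTop, |w (φ j) t y 2| ≤ α * ε / Real.sqrt (β * (-t)) := by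
        filter_upwards [e1, e4] with j hj1 hj4
        have key := hΛ _ ⟨hj1, hτT j t ht⟩ _ hj4
        rw [sqrt_zoom_window (hcpos _)] at key
        have e2 : w (φ j) t y 2 =
            c (φ j) * α * u (T + c (φ j) ^ 2 * β * t) (x₀ + (c (φ j) * R) • y) 2 := by
          rw [hwu j t y]; simp
        rw [e2]
        exact abs_zoom_vert_le (hcpos _) hα hs key
      have hlim : Tendsto (fun j => |w (φ j) t y 2|) atTop (𝓝 |W t y 2|) :=
        (((EuclideanSpace.proj (2 : Fin 3)).continuous.tendsto (W t y)).comp (hpt t ht y)).abs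
      exact le_of_tendsto hlim hev
    have h0 : |W t y 2| ≤ 0 := by
      have h := fun ε (hε : 0 < ε) => hle ε hε
      by_contra hcon
      push Not at hcon
      have hpos : 0 < |W t y 2| * Real.sqrt (β * (-t)) / α := by positivity
      have := h _ (half_pos hpos)
      rw [le_div_iff₀ hs] at this
      have hid : α * (|W t y 2| * Real.sqrt (β * (-t)) / α / 2) =
          |W t y 2| * Real.sqrt (β * (-t)) / 2 := by field_simp
      rw [hid] at this
      nlinarith [mul_pos hcon hs]
    exact abs_eq_zero.1 (le_antisymm h0 (abs_nonneg _))
  -- ## (7) assemble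
  obtain ⟨ts, hts, xs, -, hM⟩ := hsingW 1 one_pos 0
  have hne : W ts xs ≠ 0 := by
    intro h0; rw [h0, norm_zero] at hM; exact lt_irrefl _ hM
  exact ⟨C₁, W, hWclass, hvert, ts, hts.2, xs, hne⟩

/-! ## §3 Headlines -/

/-- **Criterion row F1nv is EXCLUDED** (in kernel): a classical Leray–Hopf solution from a rapidly
decaying datum with at most the Type-I rate at `T` whose fast fluid has negligible vertical component at
the Type-I scale extends smoothly past `T`.  Proof: at a would-be backward-singular point the horizontal
singular zoom limit (`exists_horizontal_zoomLimit`) is a nonzero horizontal-valued element of `𝒦_C`,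
which census row A7h (`HorizontalMeter.row_A7h_holds`, in tree) forbids; hence every point has a
bounded backward cylinder and Lemarié-Rieusset's Thm 15.1 (C) extends `u`.
[cite: LemarieRieusset2016, Thm 15.1 (C); AlbrittonBarker2019, §3; KochNadirashviliSereginSverak2009, §6] -/
theorem rowF1nv_holds : Row_F1nv := by
  intro ν T hν hT u p hsol hLH hdec hTI hnv
  apply hasSmoothExtensionPast_of_forall_exists_parabolicCylinder hν hT hsol hLH hdec
  intro x₀
  by_contra hno
  have hsing : ∀ r : ℝ, 0 < r →
      eLpNorm (uncurry u) ∞ (volume.restrict (parabolicCylinder r ((T : ℝ), x₀))) = ∞ := by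
    intro r hr
    by_contra h
    exact hno ⟨r, hr, lt_top_iff_ne_top.2 h⟩
  obtain ⟨C, W, hW, hh, t, ht, y, hne⟩ :=
    exists_horizontal_zoomLimit hν hT hsol hLH hdec hTI hnv x₀ hsing
  exact hne (row_A7h_holds C W hW hh t ht y)

/-- **Criterion row F1flat is EXCLUDED** (in kernel): Type-I rate + flat top ⇒ extension.
[cite: LemarieRieusset2016, Thm 15.1 (C); KochNadirashviliSereginSverak2009, §6] -/
theorem rowF1flat_holds : Row_F1flat := rowF1flat_of_rowF1nv rowF1nv_holds

/-- **Criterion row F1v∞ is EXCLUDED** (in kernel): Type-I rate + `√(T−t)‖u₃(t)‖_∞ → 0` ⇒ extension —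
the `q = ∞` endpoint of Kukavica–Rusin–Ziane 2017 Cor. 2.3 in the Clay frame.
[cite: KukavicaRusinZiane2016, Cor. 2.3 (p. 4); LemarieRieusset2016, Thm 15.1 (C)] -/
theorem rowF1vInf_holds : Row_F1vInf := rowF1vInf_of_rowF1nv rowF1nv_holds

/-- **The vertical component of a Type-I Clay blow-up carries the Type-I rate on every top**
(structural theorem, in kernel): a maximal classical Leray–Hopf solution from a rapidly decaying datum
which blows up at `T` at the Type-I rate has NO negligible vertical top — there is `ε₀ > 0` such that for
every level `Λ` and every `t₁ < T` some top point `(t, x)`, `t₁ < t < T`, `Λ < ‖u t x‖`, has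
`√(T−t) |u₃(t,x)| > ε₀`. [cite: KukavicaRusinZiane2016, Cor. 2.3; KochNadirashviliSereginSverak2009, §6] -/
theorem verticalPersistence_holds : ∀ (ν T : ℝ), 0 < ν → 0 < T →
    ∀ (u : ℝ → E3 → E3) (p : ℝ → E3 → ℝ),
    IsMaximalSmoothSolution ν 0 u p T → IsLerayHopfOn T ν 0 (u 0) u →
    HasRapidSpatialDecay (u 0) → IsTypeIBlowup u T → ¬ HasNegligibleVerticalTop u T :=
  fun ν T hν hT u p hmax hLH hdec hTI hnv =>
    hmax.2 (rowF1nv_holds ν T hν hT u p hmax.1 hLH hdec hTI hnv)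

/-- Corollaries: a Type-I Clay blow-up has neither a flat top nor a vanishing vertical rate. -/
theorem not_hasFlatTop_of_typeI : ∀ (ν T : ℝ), 0 < ν → 0 < T →
    ∀ (u : ℝ → E3 → E3) (p : ℝ → E3 → ℝ),
    IsMaximalSmoothSolution ν 0 u p T → IsLerayHopfOn T ν 0 (u 0) u →
    HasRapidSpatialDecay (u 0) → IsTypeIBlowup u T → ¬ HasFlatTop u T :=
  fun ν T hν hT u p hmax hLH hdec hTI hflat =>
    verticalPersistence_holds ν T hν hT u p hmax hLH hdec hTI (hflat.negligibleVerticalTop hT hTI)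

/-- A Type-I Clay blow-up has no vanishing vertical rate. -/
theorem not_hasVanishingVerticalRate_of_typeI : ∀ (ν T : ℝ), 0 < ν → 0 < T →
    ∀ (u : ℝ → E3 → E3) (p : ℝ → E3 → ℝ),
    IsMaximalSmoothSolution ν 0 u p T → IsLerayHopfOn T ν 0 (u 0) u →
    HasRapidSpatialDecay (u 0) → IsTypeIBlowup u T → ¬ HasVanishingVerticalRate u T :=
  fun ν T hν hT u p hmax hLH hdec hTI hv =>
    verticalPersistence_holds ν T hν hT u p hmax hLH hdec hTI hv.negligibleVerticalTop

/-- **Row F1 ≡ VerticalNegligibility** (exact reformulation, in kernel). [folklore] -/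
theorem verticalNegligibility_iff_rowF1 : VerticalNegligibility ↔ ScenarioCensus.Row_F1 :=
  ⟨fun h => rowF1_of rowF1nv_holds h, verticalNegligibility_of_rowF1⟩

/-- **Composition concluding the target BY NAME**: `VerticalNegligibility → Row_F1`. -/
theorem rowF1_of_verticalNegligibility : VerticalNegligibility → ScenarioCensus.Row_F1 :=
  verticalNegligibility_iff_rowF1.1

end Summit.NavierStokesRegularity.NavierStokesRegularity.Theorems.ScenarioCensus.FlatTop

namespace Summit.NavierStokesRegularity.NavierStokesRegularity.Theorems.ScenarioCensus

/-- Census row F1nv — (Type I · forward, Clay frame of `Row_F1` VERBATIM · no symmetry; instead the VALUE constraint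
«negligible vertical top»: on the top `{Λ < ‖u‖}` near `T`, `√(T−t)|u₃| ≤ ε` for every `ε` · classical Leray–Hopf from a
rapidly decaying datum): extends past `T`, BY NAME `FlatTop.Row_F1nv` (ns-idea-3 LINE «flat-top», VERBATIM).  Closed by
`row_F1nv_excluded`; the census lead books the value. -/
def Row_F1nv : Prop := FlatTop.Row_F1nv

/-- F1nv is PROVED in the tree: `FlatTop.rowF1nv_holds`.  No summit proved. -/
theorem row_F1nv_excluded : Row_F1nv := FlatTop.rowF1nv_holds

/-- In-row sub-criterion F1flat (flat top `|u₃| ≤ ε‖u‖` on the top), BY NAME `FlatTop.Row_F1flat` (VERBATIM). -/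
def Row_F1flat : Prop := FlatTop.Row_F1flat

/-- F1flat is PROVED in the tree: `FlatTop.rowF1flat_holds`. -/
theorem row_F1flat_excluded : Row_F1flat := FlatTop.rowF1flat_holds

/-- In-row sub-criterion F1v∞ (`√(T−t)‖u₃(t)‖_∞ → 0`, the `q = ∞` endpoint of Kukavica–Rusin–Ziane 2017 Cor. 2.3 in the
Clay / Type-I frame), BY NAME `FlatTop.Row_F1vInf` (VERBATIM). -/
def Row_F1vInf : Prop := FlatTop.Row_F1vInf

/-- F1v∞ is PROVED in the tree: `FlatTop.rowF1vInf_holds`. -/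
theorem row_F1vInf_excluded : Row_F1vInf := FlatTop.rowF1vInf_holds

/-- Lattice: F1nv ⇒ F1flat (`FlatTop.rowF1flat_of_rowF1nv`). -/
theorem row_F1flat_of_row_F1nv (h : Row_F1nv) : Row_F1flat := FlatTop.rowF1flat_of_rowF1nv h

/-- Lattice: F1nv ⇒ F1v∞ (`FlatTop.rowF1vInf_of_rowF1nv`). -/
theorem row_F1vInf_of_row_F1nv (h : Row_F1nv) : Row_F1vInf := FlatTop.rowF1vInf_of_rowF1nv h

/-- Display for row F1: `Row_F1 ↔ FlatTop.VerticalNegligibility` (every Type-I Clay blow-up, maximal frame, has a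
negligible vertical top) — an exact reformulation, no value change (`FlatTop.verticalNegligibility_iff_rowF1`). -/
theorem row_F1_iff_verticalNegligibility : Row_F1 ↔ FlatTop.VerticalNegligibility :=
  FlatTop.verticalNegligibility_iff_rowF1.symm

end Summit.NavierStokesRegularity.NavierStokesRegularity.Theorems.ScenarioCensus

end
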